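import Mathlib

/-!
# The depth-matroid lemma for 2×2 cancellations (supports `stub_swallowedInSmallSumset`,
crux `MomentCurveElusive`, item stmt-ValiantsHypothesis-6534, route GirthSidon, line `registered`)

Setting of the crux's residual (STRATEGY-CENSUS / LEAD-ANALYSIS-c2,c3 in the crux directory): sources
`y_j = t^{o_j} · u_j ∈ ℂ((t))` with units `u_j ∈ ℂ⟦t⟧`, `u_j(0) = 1`, and formally swallowed monomial
targets `t^{D} = Σ c_{jk} y_j y_k`.  The simplest CANCELLING targets are the *2×2 gadgets*
`t^{D} = α y_a y_b − α y_c y_d` with equal weights `o_a + o_b = o_c + o_d = w < D`; dividing by `α t^w`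
they read
  `u_a u_b − u_c u_d = κ · t^{γ}`,  `κ ≠ 0`,  `γ = D − w ≥ 1`  (the *depth* of the cancellation).
Every census of this crux names "a bound on cancellation depth" as the missing object (route file, why
it might fail: "nothing bounds cancellation depth").  This file proves the first such structural law,
valid for ARBITRARY (dense, infinitely supported) unit sources:

* `gadget_minDepth_attained_twice` — on every nontrivial `ℤ`-dependency `Σ μ_i ε_i = 0` of the signed
  incidence vectors `ε_i = e_a + e_b − e_c − e_d ∈ ℤ^n` of a family of gadgets, the minimal depth over
  the support of `μ` is attained at least twice (a valuative circuit law: the depths are the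
  "valuations" of a representable-over-`ℂ((t))`-flavoured structure on the gadget matroid);
* `card_gadgetDepths_le` — consequently the depths of any family of 2×2 gadgets on `n` unit sources
  take at most `n` distinct values (one per element of a basis of the row matroid; in fact ≤ rank).

Proof of the circuit law: the dependency gives the identity `∏_i (u_au_b / u_cu_d)^{μ_i} = 1` in the
unit group; reduce modulo `t^{g+1}`, `g` = the putative unique minimal depth at `i₀`: every other ratio
in the support becomes `1`, the ratio at `i₀` becomes `1 + η` with `η = κ t^{g}/(u_cu_d) ≠ 0`, `η² = 0`,
and `(1 + η)^{μ} = 1 + μ η ≠ 1` in characteristic zero — contradiction.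

How it is used on the line (LEAD-ANALYSIS-c4.md): in the 2×2-gadget model the born exponents are
`D_i = w_i + γ_i` with `w_i ∈ O + O` and `γ_i` from a set of ≤ n values, so `D ⊆ ⋃_γ (O + O + γ)`; and a
G2 system with polynomial units is literally a polynomial swallowing of the DEPTH curve `x ↦ (x^{γ_i})_i`
by the gadget map — the crux's question one level down.  What is NOT here: targets that are sums of ≥ 3
products (no multiplicative structure), cascades across weights, and any cover/relation conclusion.
-/

-- (Sub = Summit), so the duplicated namespace component is intended.
set_option linter.dupNamespace false

namespace Summit.ValiantsHypothesis.ValiantsHypothesis.Theorems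

open PowerSeries Finset

/-- `a ^ (∑ f) = ∏ a ^ f` for integer exponents in a commutative group (the `ℤ`-analogue of
`Finset.prod_pow_eq_pow_sum`; not in Mathlib under a stable name). [folklore] -/
theorem zpow_finset_sum_gadget {G : Type*} [CommGroup G] {ι : Type*} (x : G) (s : Finset ι)
    (f : ι → ℤ) : x ^ (∑ i ∈ s, f i) = ∏ i ∈ s, x ^ (f i) := by
  classical
  induction s using Finset.induction_on with
  | empty => simp
  | insert i s hi ih => rw [Finset.sum_insert hi, Finset.prod_insert hi, zpow_add, ih]

/-- **Gadget ratios multiply to one on a dependency.** In a commutative group, if integer weights `μ_i`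
annihilate the signed incidence vectors `e_{a_i} + e_{b_i} − e_{c_i} − e_{d_i}` (coordinatewise:
`∑_i μ_i ε_i(j) = 0` for every `j`), then `∏_i (U_{a_i} U_{b_i} / (U_{c_i} U_{d_i}))^{μ_i} = 1` for every
assignment `U` of group elements to the coordinates. [folklore] -/
theorem prod_gadgetRatio_zpow_eq_one {G : Type*} [CommGroup G] {n m : ℕ} (U : Fin n → G)
    (a b c d : Fin m → Fin n) (μ : Fin m → ℤ)
    (hdep : ∀ j : Fin n, ∑ i : Fin m, μ i *
      (((if a i = j then (1 : ℤ) else 0) + (if b i = j then 1 else 0)) -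
        ((if c i = j then 1 else 0) + (if d i = j then 1 else 0))) = 0) :
    ∏ i : Fin m, ((U (a i) * U (b i)) / (U (c i) * U (d i))) ^ (μ i) = 1 := by
  -- each single factor `U k` is the product `∏_j U_j ^ [k = j]`
  have hsingle : ∀ k : Fin n, (∏ j : Fin n, U j ^ (if k = j then (1 : ℤ) else 0)) = U k := by
    intro k
    rw [Finset.prod_eq_single k]
    · simp
    · intro j _ hj
      simp [Ne.symm hj]
    · simp
  -- hence each gadget ratio is `∏_j U_j ^ ε_i(j)`
  have hratio : ∀ i : Fin m, (U (a i) * U (b i)) / (U (c i) * U (d i)) =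
      ∏ j : Fin n, U j ^ (((if a i = j then (1 : ℤ) else 0) + (if b i = j then 1 else 0)) -
        ((if c i = j then 1 else 0) + (if d i = j then 1 else 0))) := by
    intro i
    symm
    simp only [zpow_sub, zpow_add, Finset.prod_mul_distrib, Finset.prod_inv_distrib, hsingle,
      div_eq_mul_inv]
  simp_rw [hratio, ← Finset.prod_zpow, ← zpow_mul]
  rw [Finset.prod_comm]
  have hcol : ∀ j : Fin n, (∏ i : Fin m, U j ^ ((((if a i = j then (1 : ℤ) else 0) +
      (if b i = j then 1 else 0)) - ((if c i = j then 1 else 0) + (if d i = j then 1 else 0))) * μ i))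
        = 1 := by
    intro j
    rw [← zpow_finset_sum_gadget, show (∑ i : Fin m, (((if a i = j then (1 : ℤ) else 0) +
      (if b i = j then 1 else 0)) - ((if c i = j then 1 else 0) + (if d i = j then 1 else 0))) * μ i)
        = 0 from ?_, zpow_zero]
    refine Eq.trans (Finset.sum_congr rfl fun i _ => ?_) (hdep j)
    ring
  simp [hcol]

/-- **Powers of a unipotent unit with square-zero nilpotent part.** In a commutative ring, if a unit
`x` has `↑x = 1 + η` with `η * η = 0`, then `↑(x ^ k) = 1 + k • η` for every integer `k`. [folklore] -/
theorem units_val_zpow_of_sq_zero {R : Type*} [CommRing R] (x : Rˣ) (η : R)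
    (hx : (x : R) = 1 + η) (hη : η * η = 0) (k : ℤ) :
    ((x ^ k : Rˣ) : R) = 1 + (k : R) * η := by
  -- natural powers
  have hnat : ∀ l : ℕ, ((x ^ l : Rˣ) : R) = 1 + (l : R) * η := by
    intro l
    induction l with
    | zero => simp
    | succ l ih =>
        rw [pow_succ, Units.val_mul, ih, hx]
        push_cast
        linear_combination ((l : R)) * hη
  -- the inverse is `1 - η`
  have hinv : ((x⁻¹ : Rˣ) : R) = 1 - η := by
    have h1 : (x : R) * (1 - η) = 1 := by
      rw [hx]; linear_combination (-1 : R) * hη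
    calc ((x⁻¹ : Rˣ) : R) = ((x⁻¹ : Rˣ) : R) * ((x : R) * (1 - η)) := by rw [h1, mul_one]
      _ = 1 - η := by rw [← mul_assoc, Units.inv_mul, one_mul]
  have hnat' : ∀ l : ℕ, ((x⁻¹ ^ l : Rˣ) : R) = 1 - (l : R) * η := by
    intro l
    induction l with
    | zero => simp
    | succ l ih =>
        rw [pow_succ, Units.val_mul, ih, hinv]
        push_cast
        linear_combination ((l : R)) * hη
  rcases Int.eq_nat_or_neg k with ⟨l, rfl | rfl⟩
  · rw [zpow_natCast]
    exact_mod_cast hnat l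
  · rw [zpow_neg, zpow_natCast, ← inv_pow]
    rw [hnat' l]
    push_cast
    ring

/-- **Depth-matroid circuit law for 2×2 cancellations** (the lemma of this file).
Let `u_1, …, u_n ∈ K⟦X⟧` be units normalised by `u_j(0) = 1` over a field `K` of characteristic zero,
and let `m` gadgets `(a_i, b_i; c_i, d_i)` satisfy `u_{a_i} u_{b_i} − u_{c_i} u_{d_i} = κ_i X^{γ_i}`
with `κ_i ≠ 0` and depths `γ_i ≥ 1`.  If integer weights `μ` annihilate the signed incidence vectors
`e_{a_i} + e_{b_i} − e_{c_i} − e_{d_i}` and `μ_{i₀} ≠ 0`, then some OTHER gadget `i ≠ i₀` in the support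
of `μ` has depth `γ_i ≤ γ_{i₀}`: the minimal depth on the support of a dependency is attained twice.
(New here; the toric left-kernel trick of Garg–Makam–Oliveira–Wigderson 2019 §9 is the case of
monomial sources, where the conclusion is the exact relation `⟨μ, γ⟩ = 0`.) [folklore] -/
theorem gadget_minDepth_attained_twice {K : Type*} [Field K] [CharZero K] {n m : ℕ}
    (u : Fin n → K⟦X⟧) (hu : ∀ j, constantCoeff (u j) = 1)
    (a b c d : Fin m → Fin n) (κ : Fin m → K) (γ : Fin m → ℕ)
    (hκ : ∀ i, κ i ≠ 0) (hγ : ∀ i, 1 ≤ γ i)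
    (hgad : ∀ i, u (a i) * u (b i) - u (c i) * u (d i) = C (κ i) * X ^ (γ i))
    (μ : Fin m → ℤ)
    (hdep : ∀ j : Fin n, ∑ i : Fin m, μ i *
      (((if a i = j then (1 : ℤ) else 0) + (if b i = j then 1 else 0)) -
        ((if c i = j then 1 else 0) + (if d i = j then 1 else 0))) = 0)
    (i₀ : Fin m) (hi₀ : μ i₀ ≠ 0) :
    ∃ i : Fin m, i ≠ i₀ ∧ μ i ≠ 0 ∧ γ i ≤ γ i₀ := by
  by_contra H
  push Not at H
  -- so every other gadget in the support is strictly deeper than `g := γ i₀`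
  set g : ℕ := γ i₀ with hg
  -- the quotient ring modulo `X^(g+1)`
  set I : Ideal K⟦X⟧ := Ideal.span {(X : K⟦X⟧) ^ (g + 1)} with hI
  set mk : K⟦X⟧ →+* K⟦X⟧ ⧸ I := Ideal.Quotient.mk I with hmk
  -- the sources are units
  have hunit : ∀ j, IsUnit (u j) := by
    intro j
    rw [PowerSeries.isUnit_iff_constantCoeff, hu j]
    exact isUnit_one
  -- units in the quotient
  set U : Fin n → (K⟦X⟧ ⧸ I)ˣ := fun j => (hunit j).unit.map (mk : K⟦X⟧ →* K⟦X⟧ ⧸ I) with hU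
  have hUval : ∀ j, ((U j : (K⟦X⟧ ⧸ I)ˣ) : K⟦X⟧ ⧸ I) = mk (u j) := by
    intro j; simp [hU]
  -- the product identity in the unit group of the quotient
  have hprod := prod_gadgetRatio_zpow_eq_one U a b c d μ hdep
  -- every ratio other than `i₀` in the support of `μ` is `1`
  have hdeep : ∀ i, i ≠ i₀ → μ i ≠ 0 → mk (u (a i) * u (b i)) = mk (u (c i) * u (d i)) := by
    intro i hi hμ
    have hlt : g < γ i := H i hi hμ
    rw [Ideal.Quotient.eq, hI, Ideal.mem_span_singleton, hgad i]
    exact Dvd.dvd.mul_left (pow_dvd_pow X hlt) _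
  have hratio_one : ∀ i, i ≠ i₀ → ((U (a i) * U (b i)) / (U (c i) * U (d i))) ^ (μ i) = 1 := by
    intro i hi
    by_cases hμ : μ i = 0
    · rw [hμ, zpow_zero]
    · have : U (a i) * U (b i) = U (c i) * U (d i) := by
        ext
        simp only [Units.val_mul, hUval, ← map_mul]
        exact hdeep i hi hμ
      rw [this, div_self', one_zpow]
  rw [Finset.prod_eq_single i₀ (fun i _ hi => hratio_one i hi) (by simp)] at hprod
  -- the ratio at `i₀` is `1 + η` with `η ^ 2 = 0`
  set πm : (K⟦X⟧ ⧸ I)ˣ := U (c i₀) * U (d i₀) with hπm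
  set δ : K⟦X⟧ ⧸ I := mk (C (κ i₀) * X ^ g) with hδ
  set η : K⟦X⟧ ⧸ I := δ * ((πm⁻¹ : (K⟦X⟧ ⧸ I)ˣ) : K⟦X⟧ ⧸ I) with hη
  have hplus : ((U (a i₀) * U (b i₀) : (K⟦X⟧ ⧸ I)ˣ) : K⟦X⟧ ⧸ I) = (πm : K⟦X⟧ ⧸ I) + δ := by
    simp only [hπm, Units.val_mul, hUval, ← map_mul, hδ, ← map_add]
    congr 1
    rw [← hgad i₀]; ring
  have hx : (((U (a i₀) * U (b i₀)) / (U (c i₀) * U (d i₀)) : (K⟦X⟧ ⧸ I)ˣ) : K⟦X⟧ ⧸ I) = 1 + η := by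
    rw [div_eq_mul_inv, Units.val_mul, hplus, ← hπm, add_mul, Units.mul_inv, hη]
  have hδsq : δ * δ = 0 := by
    rw [hδ, ← map_mul, Ideal.Quotient.eq_zero_iff_mem, hI, Ideal.mem_span_singleton]
    have h2 : g + 1 ≤ g + g := by have := hγ i₀; omega
    calc (X : K⟦X⟧) ^ (g + 1) ∣ X ^ (g + g) := pow_dvd_pow X h2
      _ ∣ C (κ i₀) * X ^ g * (C (κ i₀) * X ^ g) := by
          refine ⟨C (κ i₀) * C (κ i₀), ?_⟩; rw [pow_add]; ring
  have hηsq : η * η = 0 := by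
    rw [hη]
    calc δ * ↑πm⁻¹ * (δ * ↑πm⁻¹) = (δ * δ) * (↑πm⁻¹ * ↑πm⁻¹) := by ring
      _ = 0 := by rw [hδsq, zero_mul]
  -- `(1 + η)^μ = 1` forces `μ η = 0`
  have hpow := units_val_zpow_of_sq_zero _ η hx hηsq (μ i₀)
  rw [hprod, Units.val_one] at hpow
  have hμη : ((μ i₀ : ℤ) : K⟦X⟧ ⧸ I) * η = 0 := by
    have := hpow.symm
    rwa [add_eq_left] at this
  -- `μ i₀` is invertible in the `K`-algebra quotient (characteristic zero)
  have hμunit : IsUnit (((μ i₀ : ℤ) : K⟦X⟧ ⧸ I)) := by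
    have hK : IsUnit ((μ i₀ : ℤ) : K) := by
      rw [isUnit_iff_ne_zero]; exact_mod_cast hi₀
    have := hK.map (algebraMap K (K⟦X⟧ ⧸ I))
    simpa using this
  have hη0 : η = 0 := by
    rcases hμunit with ⟨w, hw⟩
    have := congrArg (fun z => ((w⁻¹ : (K⟦X⟧ ⧸ I)ˣ) : K⟦X⟧ ⧸ I) * z) hμη
    simpa [← mul_assoc, ← hw] using this
  have hδ0 : δ = 0 := by
    have : η * (πm : K⟦X⟧ ⧸ I) = δ := by rw [hη, mul_assoc, Units.inv_mul, mul_one]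
    rw [← this, hη0, zero_mul]
  -- but `X^(g+1)` does not divide `κ X^g`
  rw [hδ, Ideal.Quotient.eq_zero_iff_mem, hI, Ideal.mem_span_singleton] at hδ0
  have hcoeff := (PowerSeries.X_pow_dvd_iff).1 hδ0 g (Nat.lt_succ_self g)
  rw [PowerSeries.coeff_C_mul, PowerSeries.coeff_X_pow_self, mul_one] at hcoeff
  exact hκ i₀ hcoeff

/-- **At most `n` distinct cancellation depths.** Under the hypotheses of
`gadget_minDepth_attained_twice` (any number `m` of 2×2 gadgets on `n` normalised unit sources over a
field of characteristic zero), the depths `γ_i` take at most `n` distinct values: a transversal of the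
depth values is `ℤ`-linearly independent in `ℤ^n` by the circuit law (apply it at the gadget of minimal
depth in the support of a putative relation), and a linearly independent family in `ℤ^n` has at most
`n` members. [folklore] -/
theorem card_gadgetDepths_le {K : Type*} [Field K] [CharZero K] {n m : ℕ}
    (u : Fin n → K⟦X⟧) (hu : ∀ j, constantCoeff (u j) = 1)
    (a b c d : Fin m → Fin n) (κ : Fin m → K) (γ : Fin m → ℕ)
    (hκ : ∀ i, κ i ≠ 0) (hγ : ∀ i, 1 ≤ γ i)
    (hgad : ∀ i, u (a i) * u (b i) - u (c i) * u (d i) = C (κ i) * X ^ (γ i)) :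
    (Finset.univ.image γ).card ≤ n := by
  classical
  -- the signed incidence vectors
  set ε : Fin m → (Fin n → ℤ) := fun i j =>
    ((if a i = j then (1 : ℤ) else 0) + (if b i = j then 1 else 0)) -
      ((if c i = j then 1 else 0) + (if d i = j then 1 else 0)) with hε
  -- a transversal of the depth values
  set vals : Finset ℕ := Finset.univ.image γ with hvals
  have hsel : ∀ v : vals, ∃ i : Fin m, γ i = v := by
    rintro ⟨v, hv⟩
    obtain ⟨i, -, hi⟩ := Finset.mem_image.1 hv
    exact ⟨i, hi⟩
  choose sel hsel using hsel
  have hsel_inj : Function.Injective sel := by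
    intro v w h
    apply Subtype.ext
    rw [← hsel v, ← hsel w, h]
  -- the transversal is linearly independent over `ℤ`
  have hli : LinearIndependent ℤ (fun v : vals => ε (sel v)) := by
    rw [linearIndependent_iff']
    intro s g hsum
    by_contra hne
    push Not at hne
    -- the shallowest offending value
    obtain ⟨v₀, hv₀, hmin⟩ := Finset.exists_min_image (s.filter fun v => g v ≠ 0)
      (fun v : vals => (v : ℕ)) (by
        obtain ⟨v, hv, hgv⟩ := hne
        exact ⟨v, Finset.mem_filter.2 ⟨hv, hgv⟩⟩)
    rw [Finset.mem_filter] at hv₀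
    -- transport the relation to weights on gadgets
    set μ : Fin m → ℤ := fun i => ∑ v ∈ s, if sel v = i then g v else 0 with hμ
    have hμsel : ∀ v ∈ s, μ (sel v) = g v := by
      intro v hv
      rw [hμ]
      simp only
      rw [Finset.sum_eq_single v]
      · simp
      · intro w _ hw
        rw [if_neg fun h => hw (hsel_inj h)]
      · intro hv'; exact absurd hv hv'
    have hμoff : ∀ i, (∀ v ∈ s, sel v ≠ i) → μ i = 0 := by
      intro i hi
      rw [hμ]
      exact Finset.sum_eq_zero fun v hv => by simp [hi v hv]
    have hdep : ∀ j : Fin n, ∑ i : Fin m, μ i * ε i j = 0 := by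
      intro j
      have hj := congrFun hsum j
      simp only [Finset.sum_apply, Pi.smul_apply, smul_eq_mul, Pi.zero_apply] at hj
      rw [← hj]
      simp only [hμ, Finset.sum_mul]
      rw [Finset.sum_comm]
      refine Finset.sum_congr rfl fun v hv => ?_
      rw [Finset.sum_eq_single (sel v)]
      · simp
      · intro i _ hi; simp [Ne.symm hi]
      · simp
    obtain ⟨i, hi, hμi, hγi⟩ := gadget_minDepth_attained_twice u hu a b c d κ γ hκ hγ hgad μ
      (by simpa [hε] using hdep) (sel v₀) (by rw [hμsel v₀ hv₀.1]; exact hv₀.2)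
    -- `i` carries weight, so it is `sel w` for some offending `w`
    obtain ⟨w, hw, rfl⟩ : ∃ w ∈ s, sel w = i := by
      by_contra hno
      push Not at hno
      exact hμi (hμoff i hno)
    have hgw : g w ≠ 0 := by rwa [hμsel w hw] at hμi
    have hle : (w : ℕ) ≤ (v₀ : ℕ) := by rw [← hsel w, ← hsel v₀]; exact hγi
    have hge : (v₀ : ℕ) ≤ (w : ℕ) := hmin w (Finset.mem_filter.2 ⟨hw, hgw⟩)
    exact hi (congrArg sel (Subtype.ext (le_antisymm hle hge)))
  have hcard := hli.fintype_card_le_finrank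
  rw [Module.finrank_fin_fun ℤ, Fintype.card_coe] at hcard
  exact hcard

/-- **The born exponents of 2×2 cancellations lie in `O + O + G` with `|G| ≤ n`.**  Sources
`y_j = X^{o_j} u_j` (`u_j(0) = 1`) in `K⟦X⟧`, `char K = 0`; suppose each of `m` monomial targets is a
2×2 cancellation: `α_i (y_{a_i} y_{b_i} − y_{c_i} y_{d_i}) = X^{D_i}` with balanced weights
`o_{a_i} + o_{b_i} = o_{c_i} + o_{d_i} < D_i` (a cancellation-BORN target in the language of the crux's
census).  Then the depths `D_i − (o_{a_i} + o_{b_i})` take at most `n` values: there is `G ⊂ ℕ`,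
`|G| ≤ n`, with `D_i ∈ o_{a_i} + o_{b_i} + G` for every `i` — the exponent set of such a swallowing lies
in `⋃_{γ ∈ G} (O + O + γ)`.  (Partial result toward `stub_swallowedInSmallSumset` for the pure
2×2-gadget model; the cover form `D ⊆ U + U` would need `|O + O|` or the weight multiplicities to be
controlled as well, see LEAD-ANALYSIS-c4.md.) [folklore] -/
theorem exists_depthSet_of_twoByTwo {K : Type*} [Field K] [CharZero K] {n m : ℕ}
    (o : Fin n → ℕ) (u : Fin n → K⟦X⟧) (hu : ∀ j, constantCoeff (u j) = 1)
    (a b c d : Fin m → Fin n) (α : Fin m → K) (D : Fin m → ℕ)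
    (hw : ∀ i, o (a i) + o (b i) = o (c i) + o (d i))
    (hborn : ∀ i, o (a i) + o (b i) < D i)
    (htarget : ∀ i, C (α i) * ((X ^ (o (a i)) * u (a i)) * (X ^ (o (b i)) * u (b i)) -
      (X ^ (o (c i)) * u (c i)) * (X ^ (o (d i)) * u (d i))) = X ^ (D i)) :
    ∃ G : Finset ℕ, G.card ≤ n ∧ ∀ i, ∃ γ ∈ G, D i = o (a i) + o (b i) + γ := by
  classical
  -- depths and normalised coefficients
  set γ : Fin m → ℕ := fun i => D i - (o (a i) + o (b i)) with hγdef
  have hγ : ∀ i, 1 ≤ γ i := fun i => by have := hborn i; simp only [hγdef]; omega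
  have hD : ∀ i, D i = o (a i) + o (b i) + γ i := fun i => by
    have := hborn i; simp only [hγdef]; omega
  have hα : ∀ i, α i ≠ 0 := by
    intro i h
    have := htarget i
    rw [h, map_zero, zero_mul] at this
    exact (pow_ne_zero (D i) (PowerSeries.X_ne_zero (R := K))) this.symm
  have hgad : ∀ i, u (a i) * u (b i) - u (c i) * u (d i) = C ((α i)⁻¹) * X ^ (γ i) := by
    intro i
    have h := htarget i
    have hfac : C (α i) * ((X ^ (o (a i)) * u (a i)) * (X ^ (o (b i)) * u (b i)) -
        (X ^ (o (c i)) * u (c i)) * (X ^ (o (d i)) * u (d i))) =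
        X ^ (o (a i) + o (b i)) * (C (α i) * (u (a i) * u (b i) - u (c i) * u (d i))) := by
      rw [show X ^ (o (c i)) * u (c i) * (X ^ (o (d i)) * u (d i)) =
        X ^ (o (a i) + o (b i)) * (u (c i) * u (d i)) by rw [hw i, pow_add]; ring]
      rw [pow_add]; ring
    rw [hfac, hD i, pow_add X (o (a i) + o (b i)) (γ i)] at h
    have h' := mul_left_cancel₀ (pow_ne_zero _ (PowerSeries.X_ne_zero (R := K))) h
    calc u (a i) * u (b i) - u (c i) * u (d i)
        = C ((α i)⁻¹) * (C (α i) * (u (a i) * u (b i) - u (c i) * u (d i))) := by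
          rw [← mul_assoc, ← map_mul, inv_mul_cancel₀ (hα i), map_one, one_mul]
      _ = C ((α i)⁻¹) * X ^ (γ i) := by rw [h']
  refine ⟨Finset.univ.image γ, card_gadgetDepths_le u hu a b c d (fun i => (α i)⁻¹) γ
    (fun i => inv_ne_zero (hα i)) hγ hgad, fun i => ⟨γ i, Finset.mem_image_of_mem _ (mem_univ _), hD i⟩⟩

/-- **Registered helper stub `helper_depthCircuitLaw`** (crux stmt-ValiantsHypothesis-6534, line
`registered`): the circuit law `gadget_minDepth_attained_twice` over `ℂ`, spelled out with all binders
(minimal depth on the support of a `ℤ`-dependency of 2×2 gadgets is attained twice). [folklore] -/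
theorem helper_depthCircuitLaw : ∀ (n m : ℕ) (u : Fin n → PowerSeries ℂ) (a b c d : Fin m → Fin n) (κ : Fin m → ℂ) (γ : Fin m → ℕ) (μ : Fin m → ℤ) (i₀ : Fin m), (∀ j, PowerSeries.constantCoeff (u j) = 1) → (∀ i, κ i ≠ 0) → (∀ i, 1 ≤ γ i) → (∀ i, u (a i) * u (b i) - u (c i) * u (d i) = PowerSeries.C (κ i) * PowerSeries.X ^ (γ i)) → (∀ j : Fin n, ∑ i : Fin m, μ i * (((if a i = j then (1 : ℤ) else 0) + (if b i = j then 1 else 0)) - ((if c i = j then 1 else 0) + (if d i = j then 1 else 0))) = 0) → μ i₀ ≠ 0 → ∃ i : Fin m, i ≠ i₀ ∧ μ i ≠ 0 ∧ γ i ≤ γ i₀ :=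
  fun _ _ u a b c d κ γ μ i₀ hu hκ hγ hgad hdep hi₀ =>
    gadget_minDepth_attained_twice u hu a b c d κ γ hκ hγ hgad μ hdep i₀ hi₀

/-- **Registered helper stub `helper_depthMatroid`** (crux stmt-ValiantsHypothesis-6534, line
`registered`): `exists_depthSet_of_twoByTwo` over `ℂ`, spelled out with all binders — the born
exponents of a pure 2×2-gadget swallowing by `n` normalised unit sources lie in `O + O + G` with
`|G| ≤ n`. [folklore] -/
theorem helper_depthMatroid : ∀ (n m : ℕ) (o : Fin n → ℕ) (u : Fin n → PowerSeries ℂ) (a b c d : Fin m → Fin n) (α : Fin m → ℂ) (D : Fin m → ℕ), (∀ j, PowerSeries.constantCoeff (u j) = 1) → (∀ i, o (a i) + o (b i) = o (c i) + o (d i)) → (∀ i, o (a i) + o (b i) < D i) → (∀ i, PowerSeries.C (α i) * ((PowerSeries.X ^ (o (a i)) * u (a i)) * (PowerSeries.X ^ (o (b i)) * u (b i)) - (PowerSeries.X ^ (o (c i)) * u (c i)) * (PowerSeries.X ^ (o (d i)) * u (d i))) = PowerSeries.X ^ (D i)) → ∃ G : Finset ℕ, G.card ≤ n ∧ ∀ i,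 ∃ γ ∈ G, D i = o (a i) + o (b i) + γ :=
  fun _ _ o u a b c d α D hu hw hborn htarget =>
    exists_depthSet_of_twoByTwo o u hu a b c d α D hw hborn htarget

end Summit.ValiantsHypothesis.ValiantsHypothesis.Theorems
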